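import Literature.NumberTheory.Automorphic.UnboundedDenominatorsGeneratorAnalytic
import Literature.NumberTheory.ModularForms.QExpansionAlgebra
import Literature.NumberTheory.EllipticCurves.KleinJIntegralQExpansion
import HarnessLib

/-!
# The unbounded denominators theorem (Calegari–Dimitrov–Tang) — Proposition 3.0.1, formal side I:
# the integral `t`-expansion of the twisted generators `(λ/16)^{2m} F/Δᵐ`

PROOF-ONLY sequel (no definition, no named fact; D-0026) of `UnboundedDenominatorsFields.lean`
(generators `F/Δᵐ ∈ bddDenGens N` of CDT's field `R_N`, Definition 4.2.1) and of
`UnboundedDenominatorsGeneratorAnalytic.lean` (the twisted generator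
`h = (λ/16)^{2m} · F/Δᵐ` is holomorphic, `G ⊓ Γ(2)`-invariant and bounded at the cusps above
`λ = 0`). Source: F. Calegari, V. Dimitrov, Y. Tang, *The unbounded denominators conjecture*,
J. Amer. Math. Soc. **38** (2025), 627–702 = arXiv:2109.09040, proof of Proposition 3.0.1 and
§6.3, proof of Theorem 1.0.1 ("if `f ∈ M_k(Γ, ℚ)` has bounded denominators, then … the
`x`-expansion `x^* f` lies in `ℤ[1/N]⟦x⟧`, and is integral after `x ↦ x/C`" — display (6.3.1)).

What is proved here (sorry-free), for a finite-index `G ≤ SL(2, ℤ)` containing every conjugate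
of `T^{2n}` and `F ∈ M_{12m}(G)` with rational-integer `q_{2n}`-expansion (`t = q_{2n} = e^{πiτ/n}`):

* niceness (period `2n`, holomorphy, boundedness at `i∞`) of `F`, of `Δᵐ`, of `(λ/16)ᵏ` and of
  `h = (λ/16)^{2m} F/Δᵐ` (`nice_modularForm`, `nice_discriminant_pow`,
  `nice_modularLambda_div_sixteen_pow`, `nice_twistedGen`);
* `q`-expansions at a multiple of the period are `PowerSeries.expand`ed
  (`qExpansion_natMul_eq_expand`); hence `qExpansion (2n) (λ/16) = L(tⁿ)`
  (`qExpansion_modularLambda_div_sixteen_eq_expand`) and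
  `qExpansion (2n) Δ = t^{2n} · D(t^{2n})` with `D = ∏ (1 - qⁱ)²⁴ ∈ 1 + qℤ⟦q⟧`
  (`qExpansion_discriminant_eq_expand`);
* ★ `exists_int_qExpansion_twistedGen` — **the `t`-expansion of `h = (λ/16)^{2m} F/Δᵐ` has integer
  coefficients**: `qExpansion (2n) h = H.map ℤ→ℂ` for some `H ∈ ℤ⟦t⟧` (the poles of `Δ⁻ᵐ = t^{-2nm}·unit`
  are cancelled by `(λ/16)^{2m} = t^{2nm}·unit`), together with the Taylor-series spelling
  `taylor_cuspFunction_eq_qExpansion` used by the holonomy bound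
  `CalegariDimitrovTang2025_unboundedDenominators.dim_le_unconditional`.

This is the integrality input `hint` of the holonomy bound for the generators of `R_{2n}`; the
substitution of the formal root `x` (`xⁿ = L(tⁿ)`), the transfer of `M_2`-linear independence and
the assembly of Proposition 3.0.1 are in the sequel `UnboundedDenominatorsHolonomyInputProofs.lean`.

## References

* [CalegariDimitrovTang2025] F. Calegari, V. Dimitrov, Y. Tang, The unbounded denominators
  conjecture, J. Amer. Math. Soc. 38 (2025), no. 3, 627–702; arXiv:2109.09040. Proposition 3.0.1
  (proof), §6.3 (6.3.1).
-/

noncomputable section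

namespace Literature.NumberTheory.Automorphic

open scoped MatrixGroups ModularForm Manifold
open UpperHalfPlane hiding I
open CongruenceSubgroup Matrix.SpecialLinearGroup ModularGroup Function
open Literature.NumberTheory.ModularForms.QExpansionAlgebra
open Literature.NumberTheory.Automorphic.ModularLambda

namespace UnboundedDenominators

/-! ### §1. Niceness at the width `2n` -/

/-- A modular form on `G ≤ SL(2, ℤ)` with `Tʷ ∈ G` is nice of period `w`: `w`-periodic,
holomorphic and bounded at `i∞` (so it has a `q_w`-expansion; CDT's "cusp width dividing `w` at
`i∞`"). [cite: CalegariDimitrovTang2025, Definition 4.1.1 and Definition 4.2.1] -/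
theorem nice_modularForm {G : Subgroup SL(2, ℤ)} {k : ℤ}
    (F : ModularForm (G : Subgroup (GL (Fin 2) ℝ)) k) {w : ℕ} (hw : 0 < w) (hT : T ^ w ∈ G) :
    Periodic (⇑F ∘ ofComplex) (w : ℝ) ∧ MDiff (⇑F) ∧ IsBoundedAtImInfty (⇑F) := by
  have hper : ((w : ℕ) : ℝ) ∈ ((G : Subgroup SL(2, ℤ)) : Subgroup (GL (Fin 2) ℝ)).strictPeriods :=
    mem_strictPeriods_of_T_pow_mem hT
  haveI : Fact (IsCusp OnePoint.infty ((G : Subgroup SL(2, ℤ)) : Subgroup (GL (Fin 2) ℝ))) :=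
    ⟨Subgroup.isCusp_of_mem_strictPeriods (Nat.cast_pos.mpr hw) hper⟩
  exact ⟨SlashInvariantFormClass.periodic_comp_ofComplex F hper, ModularFormClass.holo F,
    ModularFormClass.bdd_at_infty F⟩

/-- `Δ` is nice of period `1`. [folklore] -/
private theorem nice_discriminant :
    Periodic (ModularForm.discriminant ∘ ofComplex) (1 : ℝ) ∧ MDiff ModularForm.discriminant ∧
      IsBoundedAtImInfty ModularForm.discriminant := by
  refine ⟨?_, CuspForm.discriminant.holo', ModularForm.discriminant_isZeroAtImInfty.isBoundedAtImInfty⟩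
  have h := SlashInvariantFormClass.periodic_comp_ofComplex (CuspForm.discriminant)
    one_mem_strictPeriods_SL
  simpa only [CuspForm.coe_discriminant] using h

/-- `Δᵐ` is nice of every integer period `w`. [folklore] -/
private theorem nice_discriminant_pow (w : ℕ) (m : ℕ) :
    Periodic ((fun τ : ℍ ↦ ModularForm.discriminant τ ^ m) ∘ ofComplex) (w : ℝ) ∧
      MDiff (fun τ : ℍ ↦ ModularForm.discriminant τ ^ m) ∧
      IsBoundedAtImInfty (fun τ : ℍ ↦ ModularForm.discriminant τ ^ m) := by
  have h := nice_natMul w (nice_pow nice_discriminant m)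
  simp only [mul_one] at h
  exact h

/-- `(λ/16)ᵏ` is nice of period `2n`. [folklore] -/
private theorem nice_modularLambda_div_sixteen_pow (n k : ℕ) :
    Periodic ((fun τ : ℍ ↦ (modularLambda τ / 16) ^ k) ∘ ofComplex) ((2 * n : ℕ) : ℝ) ∧
      MDiff (fun τ : ℍ ↦ (modularLambda τ / 16) ^ k) ∧
      IsBoundedAtImInfty (fun τ : ℍ ↦ (modularLambda τ / 16) ^ k) := by
  have h := nice_natMul n (nice_pow ⟨periodic_modularLambda_div_sixteen,
    mdifferentiable_modularLambda_div_sixteen, isBoundedAtImInfty_modularLambda_div_sixteen⟩ k)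
  have e : ((n : ℝ) * 2 : ℝ) = ((2 * n : ℕ) : ℝ) := by push_cast; ring
  rw [e] at h
  exact h

/-- `λ/16` is nice of period `2n` (`λ/16 = L(q_2) = L(tⁿ)`, `t = q_{2n}`).
[cite: CalegariDimitrovTang2025, §3, proof of Proposition 3.0.1 (display (xt))] -/
theorem nice_modularLambda_div_sixteen_width (n : ℕ) :
    Periodic ((fun τ : ℍ ↦ modularLambda τ / 16) ∘ ofComplex) ((2 * n : ℕ) : ℝ) ∧
      MDiff (fun τ : ℍ ↦ modularLambda τ / 16) ∧
      IsBoundedAtImInfty (fun τ : ℍ ↦ modularLambda τ / 16) := by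
  simpa only [pow_one] using nice_modularLambda_div_sixteen_pow n 1

/-- **The twisted generator `h = (λ/16)^{2m} F/Δᵐ` is nice of period `2n`** for `F ∈ M_{12m}(G)`,
`G` containing every conjugate of `T^{2n}` (period: `T^{2n} ∈ G ⊓ Γ(2)`; holomorphy and
boundedness at `i∞`: `UnboundedDenominatorsGeneratorAnalytic`).
[cite: CalegariDimitrovTang2025, §6.3, proof of Theorem 1.0.1] -/
theorem nice_twistedGen {G : Subgroup SL(2, ℤ)} [G.FiniteIndex] {m n : ℕ}
    (hconj : ∀ g : SL(2, ℤ), g * T ^ (2 * n) * g⁻¹ ∈ G)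
    (F : ModularForm (G : Subgroup (GL (Fin 2) ℝ)) (12 * (m : ℤ))) :
    Periodic ((fun τ : ℍ ↦ (modularLambda τ / 16) ^ (2 * m) *
        (F τ / ModularForm.discriminant τ ^ m)) ∘ ofComplex) ((2 * n : ℕ) : ℝ) ∧
      MDiff (fun τ : ℍ ↦ (modularLambda τ / 16) ^ (2 * m) *
        (F τ / ModularForm.discriminant τ ^ m)) ∧
      IsBoundedAtImInfty (fun τ : ℍ ↦ (modularLambda τ / 16) ^ (2 * m) *
        (F τ / ModularForm.discriminant τ ^ m)) := by
  have hT : T ^ (2 * n) ∈ G := by simpa using hconj 1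
  have hT2 : T ^ (2 * n) ∈ CongruenceSubgroup.Gamma 2 := by
    have h := ModularGroup_T_pow_mem_Gamma 2 ((2 * n : ℕ) : ℤ) ⟨n, by push_cast; ring⟩
    rwa [zpow_natCast] at h
  refine ⟨?_, mdifferentiable_modularLambda_pow_mul_modFun F, ?_⟩
  · -- periodicity from invariance under `T^{2n} ∈ G ⊓ Γ(2)`
    intro z
    simp only [comp_apply]
    by_cases hz : 0 < z.im
    · have hz' : 0 < (z + ((2 * n : ℕ) : ℝ)).im := by simpa using hz
      rw [ofComplex_apply_of_im_pos hz', ofComplex_apply_of_im_pos hz]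
      have key := modularLambda_pow_mul_modFun_smul F hT hT2 ⟨z, hz⟩
      have e : (T ^ (2 * n) • (⟨z, hz⟩ : ℍ) : ℍ) = ⟨z + ((2 * n : ℕ) : ℝ), hz'⟩ := by
        apply UpperHalfPlane.ext
        have hc : ((⟨z, hz⟩ : ℍ) : ℂ) = z := rfl
        have hc' : ((⟨z + ((2 * n : ℕ) : ℝ), hz'⟩ : ℍ) : ℂ) = z + ((2 * n : ℕ) : ℝ) := rfl
        rw [← zpow_natCast, UpperHalfPlane.modular_T_zpow_smul, UpperHalfPlane.coe_vadd, hc, hc']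
        push_cast
        ring
      rw [e] at key
      exact key
    · have hz' : ¬ 0 < (z + ((2 * n : ℕ) : ℝ)).im := by simpa using hz
      rw [ofComplex_apply_of_im_nonpos (not_lt.mp hz'), ofComplex_apply_of_im_nonpos (not_lt.mp hz)]
  · have h := isBoundedAtImInfty_modularLambda_pow_mul_modFun_smul F (γ := 1) (fun τ ↦ by
      rw [one_smul])
    simpa only [one_smul] using h

/-! ### §2. `q`-expansions at a multiple of the period -/

/-- **`q`-expansion at a multiple of the period = `PowerSeries.expand`.** For `F` nice of period
`H > 0` and `n ≠ 0`, `qExpansion (n H) F = expand n (qExpansion H F)`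
(`q_{nH}ⁿ = q_H`; CDT's passage from `q` to the local parameter `t` with `tᴺ = q`).
[cite: CalegariDimitrovTang2025, §3, proof of Proposition 3.0.1 (display (xt))] -/
theorem qExpansion_natMul_eq_expand {F : ℍ → ℂ} {H : ℝ} {n : ℕ} (hn : n ≠ 0) (hH : 0 < H)
    (hF : Periodic (F ∘ ofComplex) H ∧ MDiff F ∧ IsBoundedAtImInfty F) :
    qExpansion ((n : ℝ) * H) F = PowerSeries.expand n hn (qExpansion H F) := by
  ext m
  rw [qExpansion_natMul_coeff hn rfl hH hF, PowerSeries.coeff_expand]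

/-- **`qExpansion (2n) (λ/16) = L(tⁿ)`** (`t = q_{2n} = e^{πiτ/n}`, `tⁿ = q_2`).
[cite: CalegariDimitrovTang2025, §3, proof of Proposition 3.0.1 (display (xt))] -/
theorem qExpansion_modularLambda_div_sixteen_eq_expand {n : ℕ} (hn : n ≠ 0) {L : PowerSeries ℤ}
    (hL : qExpansion 2 (fun τ : ℍ ↦ modularLambda τ / 16) = L.map (Int.castRingHom ℂ)) :
    qExpansion ((2 * n : ℕ) : ℝ) (fun τ : ℍ ↦ modularLambda τ / 16) =
      PowerSeries.expand n hn (L.map (Int.castRingHom ℂ)) := by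
  have e : ((2 * n : ℕ) : ℝ) = (n : ℝ) * 2 := by push_cast; ring
  rw [e, qExpansion_natMul_eq_expand hn two_pos ⟨periodic_modularLambda_div_sixteen,
    mdifferentiable_modularLambda_div_sixteen, isBoundedAtImInfty_modularLambda_div_sixteen⟩, hL]

/-- **`qExpansion w Δ = tʷ · D(tʷ)`** with `D = ∏ (1 - qⁱ)²⁴ ∈ ℤ⟦q⟧` the tree's `formalDeltaUnit`
(Jacobi's product `Δ = q ∏ (1-qⁱ)²⁴`, `q = tʷ`). [cite: Serre1973, Ch. VII §4.4 Thm. 6] -/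
theorem qExpansion_discriminant_eq_expand {w : ℕ} (hw : w ≠ 0) :
    qExpansion (w : ℝ) ModularForm.discriminant = PowerSeries.X ^ w *
      (PowerSeries.expand w hw Literature.NumberTheory.EllipticCurves.formalDeltaUnit).map
        (Int.castRingHom ℂ) := by
  have h := qExpansion_natMul_eq_expand hw one_pos nice_discriminant
  rw [mul_one] at h
  rw [h, Literature.NumberTheory.EllipticCurves.qExpansion_discriminant, ← PowerSeries.map_expand,
    map_mul, PowerSeries.expand_X, map_mul, map_pow, PowerSeries.map_X]

/-- A nice function whose `q`-expansion at period `w` has integer coefficients has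
`qExpansion w F = P.map ℤ→ℂ` for an integer series `P`. [folklore] -/
private theorem exists_int_qExpansion_of_forall_coeff {w : ℝ} {F : ℍ → ℂ}
    (hint : ∀ k : ℕ, ∃ z : ℤ, PowerSeries.coeff k (qExpansion w F) = (z : ℂ)) :
    ∃ P : PowerSeries ℤ, qExpansion w F = P.map (Int.castRingHom ℂ) := by
  choose z hz using hint
  refine ⟨PowerSeries.mk z, ?_⟩
  ext k
  rw [hz k, PowerSeries.coeff_map, PowerSeries.coeff_mk, eq_intCast]

/-! ### §3. The integral `t`-expansion of `h = (λ/16)^{2m} F/Δᵐ` -/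

/-- Pointwise: `h · Δᵐ = (λ/16)^{2m} · F` (`Δ` does not vanish on `ℍ`).
[folklore] -/
private theorem twistedGen_mul_discriminant_pow {Γ : Subgroup (GL (Fin 2) ℝ)} {k : ℤ} {m : ℕ}
    (F : ModularForm Γ k) :
    (fun τ : ℍ ↦ (modularLambda τ / 16) ^ (2 * m) * (F τ / ModularForm.discriminant τ ^ m)) *
        (fun τ : ℍ ↦ ModularForm.discriminant τ ^ m) =
      (fun τ : ℍ ↦ (modularLambda τ / 16) ^ (2 * m)) * (⇑F) := by
  funext τ
  have hΔ : ModularForm.discriminant τ ^ m ≠ 0 := pow_ne_zero _ (ModularForm.discriminant_ne_zero τ)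
  simp only [Pi.mul_apply]
  rw [mul_assoc, div_mul_cancel₀ _ hΔ]

/-- ★ **The `t`-expansion of `h = (λ/16)^{2m} F/Δᵐ` is integral** (`t = q_{2n}`): for `G` of finite
index containing every conjugate of `T^{2n}`, `F ∈ M_{12m}(G)` with `F ∈ ℤ⟦q_{2n}⟧`, there is
`H ∈ ℤ⟦t⟧` with `qExpansion (2n) h = H`. Indeed `h · Δᵐ = (λ/16)^{2m} F` at the level of
`q_{2n}`-expansions, `Δᵐ = t^{2nm}·E` and `(λ/16)^{2m} = t^{2nm}·Λ` with `E, Λ ∈ ℤ⟦t⟧`, `E(0) = 1`, so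
`H = Λ · F · E⁻¹`. This is CDT's "`x^* f ∈ ℤ[1/N]⟦x⟧`" before the substitution `t = t(x)`.
[cite: CalegariDimitrovTang2025, §6.3, proof of Theorem 1.0.1 (6.3.1)] -/
theorem exists_int_qExpansion_twistedGen {G : Subgroup SL(2, ℤ)} [G.FiniteIndex] {m n : ℕ}
    (hn : 0 < n) (hconj : ∀ g : SL(2, ℤ), g * T ^ (2 * n) * g⁻¹ ∈ G)
    (F : ModularForm (G : Subgroup (GL (Fin 2) ℝ)) (12 * (m : ℤ)))
    (hint : ∀ k : ℕ, ∃ z : ℤ, PowerSeries.coeff k (qExpansion ((2 * n : ℕ) : ℝ) F) = (z : ℂ)) :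
    ∃ H : PowerSeries ℤ, qExpansion ((2 * n : ℕ) : ℝ)
      (fun τ : ℍ ↦ (modularLambda τ / 16) ^ (2 * m) * (F τ / ModularForm.discriminant τ ^ m)) =
        H.map (Int.castRingHom ℂ) := by
  have h2n : (2 * n : ℕ) ≠ 0 := by omega
  have h2n' : (0 : ℝ) < ((2 * n : ℕ) : ℝ) := by exact_mod_cast Nat.pos_of_ne_zero h2n
  have hT : T ^ (2 * n) ∈ G := by simpa using hconj 1
  obtain ⟨L, hL0, hL1, -, hL⟩ := exists_qExpansion_modularLambda_div_sixteen_eq_map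
  obtain ⟨P, hP⟩ := exists_int_qExpansion_of_forall_coeff hint
  -- the four nice functions
  have nh := nice_twistedGen hconj F
  have nΔ := nice_discriminant_pow (2 * n) m
  have nlam := nice_modularLambda_div_sixteen_pow n (2 * m)
  have nF := nice_modularForm F (Nat.pos_of_ne_zero h2n) hT
  -- `qExp h * qExp Δᵐ = qExp (λ/16)^{2m} * qExp F`
  have key := congrArg (qExpansion ((2 * n : ℕ) : ℝ)) (twistedGen_mul_discriminant_pow (m := m) F)
  rw [qExpansion_mul_of_nice h2n' nh nΔ, qExpansion_mul_of_nice h2n' nlam nF] at key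
  -- `qExp Δᵐ = X^{2nm} * E`, `qExp (λ/16)^{2m} = X^{2nm} * Λ`
  set D : PowerSeries ℤ := PowerSeries.expand (2 * n) h2n
    Literature.NumberTheory.EllipticCurves.formalDeltaUnit with hD
  have hΔm : qExpansion ((2 * n : ℕ) : ℝ) (fun τ : ℍ ↦ ModularForm.discriminant τ ^ m) =
      PowerSeries.X ^ (2 * n * m) * (D ^ m).map (Int.castRingHom ℂ) := by
    have h := qExpansion_pow_of_nice h2n' (nice_discriminant_pow (2 * n) 1) m
    simp only [pow_one] at h
    change qExpansion ((2 * n : ℕ) : ℝ) ((fun τ : ℍ ↦ ModularForm.discriminant τ) ^ m) = _ at h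
    have e : ((fun τ : ℍ ↦ ModularForm.discriminant τ) ^ m) =
        fun τ : ℍ ↦ ModularForm.discriminant τ ^ m := by funext τ; simp
    rw [e] at h
    rw [h, show (fun τ : ℍ ↦ ModularForm.discriminant τ) = ModularForm.discriminant from rfl,
      qExpansion_discriminant_eq_expand h2n, mul_pow, ← pow_mul, map_pow]
  -- `L = X * L₁`
  set L₁ : PowerSeries ℤ := PowerSeries.mk fun p ↦ PowerSeries.coeff (p + 1) L with hL₁
  have hLX : L = PowerSeries.X * L₁ := by
    have h := PowerSeries.sub_const_eq_X_mul_shift L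
    rw [show PowerSeries.constantCoeff L = 0 by
      rw [← PowerSeries.coeff_zero_eq_constantCoeff_apply]; exact hL0, map_zero, sub_zero] at h
    exact h
  have hlamm : qExpansion ((2 * n : ℕ) : ℝ) (fun τ : ℍ ↦ (modularLambda τ / 16) ^ (2 * m)) =
      PowerSeries.X ^ (2 * n * m) *
        ((PowerSeries.expand n hn.ne' L₁) ^ (2 * m)).map (Int.castRingHom ℂ) := by
    have h := qExpansion_pow_of_nice h2n' (nice_modularLambda_div_sixteen_width n) (2 * m)
    have e : ((fun τ : ℍ ↦ modularLambda τ / 16) ^ (2 * m)) =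
        fun τ : ℍ ↦ (modularLambda τ / 16) ^ (2 * m) := by funext τ; simp
    rw [e] at h
    rw [h, qExpansion_modularLambda_div_sixteen_eq_expand hn.ne' hL, ← PowerSeries.map_expand, hLX,
      map_mul, PowerSeries.expand_X, map_mul, map_pow, PowerSeries.map_X,
      mul_pow, ← pow_mul, map_pow, show n * (2 * m) = 2 * n * m by ring]
  rw [hΔm, hlamm, hP] at key
  -- cancel `X^{2nm}`
  have hX : (PowerSeries.X : PowerSeries ℂ) ^ (2 * n * m) ≠ 0 := pow_ne_zero _ PowerSeries.X_ne_zero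
  have key' : qExpansion ((2 * n : ℕ) : ℝ)
      (fun τ : ℍ ↦ (modularLambda τ / 16) ^ (2 * m) * (F τ / ModularForm.discriminant τ ^ m)) *
        (D ^ m).map (Int.castRingHom ℂ) =
      ((PowerSeries.expand n hn.ne' L₁) ^ (2 * m) * P).map (Int.castRingHom ℂ) := by
    apply mul_left_cancel₀ hX
    rw [map_mul, ← mul_assoc, ← mul_assoc, mul_comm (PowerSeries.X ^ (2 * n * m)), mul_assoc]
    exact key
  -- `D^m` has constant coefficient `1`, hence is a unit of `ℤ⟦t⟧`
  have hDc : PowerSeries.constantCoeff (D ^ m) = 1 := by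
    rw [map_pow, hD, PowerSeries.constantCoeff_expand,
      Literature.NumberTheory.EllipticCurves.constantCoeff_formalDeltaUnit, one_pow]
  set E : PowerSeries ℤ := PowerSeries.invOfUnit (D ^ m) 1 with hE
  have hDE : D ^ m * E = 1 := PowerSeries.mul_invOfUnit (D ^ m) 1 (by rw [hDc, Units.val_one])
  refine ⟨(PowerSeries.expand n hn.ne' L₁) ^ (2 * m) * P * E, ?_⟩
  calc qExpansion ((2 * n : ℕ) : ℝ)
        (fun τ : ℍ ↦ (modularLambda τ / 16) ^ (2 * m) * (F τ / ModularForm.discriminant τ ^ m))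
      = qExpansion ((2 * n : ℕ) : ℝ)
          (fun τ : ℍ ↦ (modularLambda τ / 16) ^ (2 * m) * (F τ / ModularForm.discriminant τ ^ m)) *
          (D ^ m * E).map (Int.castRingHom ℂ) := by rw [hDE, map_one, mul_one]
    _ = ((PowerSeries.expand n hn.ne' L₁) ^ (2 * m) * P * E).map (Int.castRingHom ℂ) := by
          rw [map_mul _ (D ^ m), ← mul_assoc, key', ← map_mul]

/-- The Taylor series of the cusp function, spelled with `/ n!` as in the holonomy bound
`CalegariDimitrovTang2025_unboundedDenominators.dim_le_unconditional`, is Mathlib's `qExpansion`.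
[cite: CalegariDimitrovTang2025, §3, proof of Proposition 3.0.1 (display (xt))] -/
theorem taylor_cuspFunction_eq_qExpansion (w : ℝ) (F : ℍ → ℂ) :
    (PowerSeries.mk fun k ↦ iteratedDeriv k (cuspFunction w F) 0 / k.factorial) = qExpansion w F := by
  ext k
  rw [PowerSeries.coeff_mk, qExpansion_coeff, div_eq_inv_mul]

/-- ★ restated for the holonomy bound: the Taylor series in `t = q_{2n}` of the cusp function of
`h = (λ/16)^{2m} F/Δᵐ` is an integer series. [cite: CalegariDimitrovTang2025, §6.3, proof of
Theorem 1.0.1 (6.3.1)] -/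
theorem exists_int_taylor_twistedGen {G : Subgroup SL(2, ℤ)} [G.FiniteIndex] {m n : ℕ}
    (hn : 0 < n) (hconj : ∀ g : SL(2, ℤ), g * T ^ (2 * n) * g⁻¹ ∈ G)
    (F : ModularForm (G : Subgroup (GL (Fin 2) ℝ)) (12 * (m : ℤ)))
    (hint : ∀ k : ℕ, ∃ z : ℤ, PowerSeries.coeff k (qExpansion ((2 * n : ℕ) : ℝ) F) = (z : ℂ)) :
    ∃ H : PowerSeries ℤ, (PowerSeries.mk fun k ↦ iteratedDeriv k (cuspFunction ((2 * n : ℕ) : ℝ)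
      (fun τ : ℍ ↦ (modularLambda τ / 16) ^ (2 * m) * (F τ / ModularForm.discriminant τ ^ m))) 0 /
        k.factorial) = H.map (Int.castRingHom ℂ) := by
  rw [taylor_cuspFunction_eq_qExpansion]
  exact exists_int_qExpansion_twistedGen hn hconj F hint

end UnboundedDenominators

end Literature.NumberTheory.Automorphic

end
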